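import Summits.CriticalPhenomena.PercolationContinuityZ3.Theorems.Transplant.D10SKc00_1155P1
import HarnessLib

/-!
# Diamond film `D_10` — KERNEL CERTIFICATE for the class `00_1155` of `ShapedLinkageX 4 (DiamondFilm.sqShadow (k := 10))`, THE CLASS (mask + coverage from the 1 parts) (template `fullmcp`, |W| = 131, 1806 terminal pairs, 5512 plans)

builds on p205010 (kernel theorem, internal audit signed; external expert review pending) — NOT used in this file.  Lane `prim-bschramm`, seat `prim-bschramm-p2` (gen 43; class C1b;
memo `HOME/bschramm/P2-LATTICES.md` §152); helper file (`--supports stmt-CriticalPhenomena-4575 --as helper`).  Generated by `cert/emit_dk.py` from the plans of `cert/gen_dk.py`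
(canonical BFS routings with avoid hints, exact mirror `cert/kern_dk.py` of «DkSKDefs»); re-checked here by the kernel (`DCtx.checkEs`); `caseOK_k10_00_1155` feeds «D10SKFinal».
[cite: DuminilCopinSidoraviciusTassion2016, §2.3 (proof of Fact 2: the three disjoint paths in B_R(z))]
-/

namespace Summit.CriticalPhenomena.PercolationContinuityZ3.Theorems.Transplant

namespace DiamondFilm.DK

/-- The cleared mask of the class `00_1155` of `D_10` is admissible (inside the cleared block, containing the forced core). [folklore] -/
theorem wOK_k10_00_1155 : DCtx.wOK (⟨10, 0, 0, 1, 1, 5, 5, 582829745128948772455500762674537960648492032091102649310647573914930988633624745473613432857344746792179548160⟩ : DCtx) = true := by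
  decide +kernel

/-- **THE CLASS `00_1155` OF `D_10` IS COVERED**: every needed bit of every certified terminal pair has a swap-pair plan. [cite: DuminilCopinSidoraviciusTassion2016, §2.3 (proof of Fact 2)] -/
theorem caseOK_k10_00_1155 : CaseOK (⟨10, 0, 0, 1, 1, 5, 5, 582829745128948772455500762674537960648492032091102649310647573914930988633624745473613432857344746792179548160⟩ : DCtx) :=
  caseOK_of_chunks _ [[14, 16, 18, 20, 25, 27], [29, 31, 33, 49, 57, 74], [80, 158, 159, 160, 161, 162], [163, 164, 169, 177, 181, 189], [193, 201, 205, 213, 218, 224], [303, 305, 307, 313, 321, 325], [333, 337, 345, 349, 357, 363], [367]]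
    (List.forall_mem_cons.2 ⟨checkEs_sound _ _ _ chunk_k10_00_1155_0, List.forall_mem_cons.2 ⟨checkEs_sound _ _ _ chunk_k10_00_1155_1, List.forall_mem_cons.2 ⟨checkEs_sound _ _ _ chunk_k10_00_1155_2, List.forall_mem_cons.2 ⟨checkEs_sound _ _ _ chunk_k10_00_1155_3, List.forall_mem_cons.2 ⟨checkEs_sound _ _ _ chunk_k10_00_1155_4, List.forall_mem_cons.2 ⟨checkEs_sound _ _ _ chunk_k10_00_1155_5, List.forall_mem_cons.2 ⟨checkEs_sound _ _ _ chunk_k10_00_1155_6, List.forall_mem_cons.2 ⟨checkEs_sound _ _ _ chunk_k10_00_1155_7, List.forall_mem_nil _⟩⟩⟩⟩⟩⟩⟩⟩)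
    (by decide +kernel)

end DiamondFilm.DK

end Summit.CriticalPhenomena.PercolationContinuityZ3.Theorems.Transplant
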